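import Summits.Ventures.CertifiedManyBodySolver.Certificates.S1Rm2uTierP.Reps01
import Summits.Ventures.CertifiedManyBodySolver.Certificates.S1Rm2uTierP.Reps02
import Summits.Ventures.CertifiedManyBodySolver.Certificates.S1Rm2uTierP.Reps03
import Summits.Ventures.CertifiedManyBodySolver.Rows.CorrWindowCertKernelHintCode

/-!
# tier-P instance (S1Rm2u-R13-W3) — hint class table (assembly) and tree depth

Generated by hubbard-algo-p2's untrusted exporter (emit_v0.py + emit_w3.py); every datum below is re-derived / re-checked by the kernel chain
(`stepEQA`, Rows/CorrWindowCertKernelChainQuotAdj.lean) or is inert. HONEST FRAMING (xx1): instance data / kernel replay of a CONTROL/CALIBRATION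
certificate (S1′-Rm2-u″ INNER pinned spoke of the La214-E t′-pair {hub′ −3/10, S1′ −1/5}: t′ = −1/5, OWN f-sum objective, eom multipliers PINNED to the hub-Rm2-u′ certificate (EB by name), sdp-1 (R1) C-edition j326976, 4^40-dyadic two-level Gram factors); nothing here is a theorem about the Hubbard model; no summit statement. [cite: Han2020Bootstrap, §3]
-/

set_option linter.style.longLine false
set_option maxRecDepth 100000
set_option maxHeartbeats 0

namespace Summit.Ventures.CertifiedManyBodySolver
namespace CARPolyWindow.TierP.S1Rm2u
open Summit.Ventures.CertifiedQuantumChemistry Summit.Ventures.CertifiedQuantumChemistry.CARPoly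
open Literature.MathematicalPhysics.QuantumLattice Literature.MathematicalPhysics.QuantumLattice.HubbardWave0
open Literature.Probability.LatticeModels
open CARPolyWindow

/-- The 14291 hint base monomials (κ₀ / κ₀† per licensed class, and the own preimage of kernel-zero monomials), first-use order. [folklore] -/
def reps : List (CARPoly.Mono (Orb (Fin 169))) := (reps01 ++ reps02 ++ reps03).map fun e => (e.1.map dec, e.2.map dec)

/-- positional-tree depth for `hintsOfCodes` (2^14 ≥ 14291 entries). [folklore] -/
def Dr : ℕ := 14

end CARPolyWindow.TierP.S1Rm2u
end Summit.Ventures.CertifiedManyBodySolver
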